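import Summits.AtomisticToContinuum.BoseEinsteinCondensation.Theorems.GaussianDominationCan.Negative.CruxForms
import Summits.AtomisticToContinuum.BoseEinsteinCondensation.Theorems.BECThomsonPrincipleDensityResponseDefs
import Summits.AtomisticToContinuum.BoseEinsteinCondensation.Theorems.BECThomsonPrincipleGaussianDominationCanWardChord
import HarnessLib

/-!
# Route `BECThomsonPrinciple`, crux `GaussianDominationCan` (stmt-AtomisticToContinuum-9479):
# vocabulary and stub statements of the line `ward-chord-splitting`

Route-posited objects (D-0016 `<Route><Crux>…Defs` file; precedent `BECThomsonPrincipleGaussianDominationCanDefs.lean`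
of the sibling line `coupling-monotone-chord`) shared by the registered stubs of the checked skeleton
`Cruxes/GaussianDominationCan/Lines/ward-chord-splitting.lean` (second line lead, unit line-stmt-AtomisticToContinuum-9479-b)
and by the files that compose them (`…WardSplitComposition.lean`, `…WardSplitBridge.lean`).  NOTHING IS ASSERTED here:
every `def … : Prop` is a *statement* (a stub signature or an intermediate goal), consumed only as the type of a stub
theorem or as an explicit hypothesis of a composition theorem; `WardChord` (S1) is PROVED, definition-free, in
`BECThomsonPrincipleGaussianDominationCanWardChord.lean` (`wardChord`) and re-read in this vocabulary by
`wardChord_holds` below (definitional unfolding).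

**The crux** (`Theses/BECThomsonPrinciple.lean`, `def GaussianDominationCan`; in the disprover's landed vocabulary
`Negative.CruxForms` it is `∀ v M, ∃ ρ₀ C N₀, GDCanWith ρ₀ C N₀ v M` by `Iff.rfl`): the chord (Gaussian-domination)
inequality `E₀(v) + s·2N|I(Φ)| ≤ E_v(Φ) + C s² L²/‖n‖∞²` for the Lewin–Nam–Serfaty–Solovej source `Λ_k† = a_k†a_0 n̂₀^{-1/2}`,
all `s ≥ 0`, all periodic Bose trial states, uniformly down the density scale.

**The line** (card `Cruxes/GaussianDominationCan/Ideas/ward-chord-splitting.md`, line card `Lines/ward-chord-splitting.md`).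
Per particle, with `A = (k·p)∘e^{ik·x}`, `P` = cell average, `Q = 1 − P`: `PA = 0` on periodic functions and
`AP = |k|²e^{ik·x}P`, so the c-number condensate source `X = ⟨a_k†a_0⟩ = ⟨∑ᵢe^{ik·xᵢ}Pᵢ⟩` satisfies
`|k|²X = kCurrent − backflow`, `kCurrent = (|k|²/2)(D₀ + iD_{−π/2}) + (Im W₀ + i Im W_{−π/2})` (half `|k|² ×` the density
wave plus the longitudinal current).  S1 `WardChord` (f-sum rule in chord form, PROVED) settles `Im W_θ`; S2
`WeakDensityChord` (= the route's `DensityResponse` weakened; bridge proved in `…WardSplitBridge.lean`) settles `D_θ`; S3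
`BackflowChord` is the chord for the no-condensate-leg current `backflow` (open; by `cnumberGD_of` /
`backflowChord_of_cnumberGD` it is EQUIVALENT to `CNumberGD` modulo S1 ∧ S2); S4 `NormalisationLift` carries
`CNumberGD → crux` (Bose symmetry `∑ᵢ ↦ (m+1)×` particle 0; Josephson factor; BEC-strength).

Objects (the wave-vector vocabulary `kvec`, `ksq`, `ksupSq` and the comparisons `ksupSq_le_ksq`, `ksq_le_three_mul_ksupSq` are REUSED
from the sibling line's `BECThomsonPrincipleDensityResponseDefs.lean`, namespace `…Cruxes.DensityResponse.ForceBalanceConstitutive`, per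
review of p86125 — one `ksq` for the whole route): `karg`, `kDeriv`, `phasedCurrent`, `densityWave`, `condensateSource`, `kCurrent`,
`backflow`; statements `WardChord`, `WeakDensityChord`, `BackflowChord`, `CNumberGD`, `NormalisationLift`; audit aliases
`Goal.stub_*`; elementary lemmas on `ksq`/`ksupSq` and on chord ⇔ square forms.

References: Pines–Nozières, *The Theory of Quantum Liquids* (f-sum rule); A. Griffin, *Excitations in a Bose-condensed
Liquid* §6.1; LSSY2005 §5.2; M. Lewin, P. T. Nam, S. Serfaty, J. P. Solovej, arXiv:1211.2778 (excitation map).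
-/

noncomputable section

namespace Summit.AtomisticToContinuum.BoseEinsteinCondensation.Cruxes.GaussianDominationCan.WardChordSplitting

open MeasureTheory
open scoped ENNReal ComplexConjugate
open Literature.MathematicalPhysics.QuantumManyBody.BoseGas
open Summit.AtomisticToContinuum.BoseEinsteinCondensation.Theses
open Summit.AtomisticToContinuum.BoseEinsteinCondensation.Theorems.GaussianDominationCan.Negative
open Summit.AtomisticToContinuum.BoseEinsteinCondensation.Cruxes.DensityResponse.ForceBalanceConstitutive
  (kvec ksq ksupSq ksupSq_le_ksq ksq_le_three_mul_ksupSq)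

/-! ### Vocabulary of the line (all over existing declarations; `kvec`/`ksq`/`ksupSq` opened from DensityResponseDefs) -/

section Vocabulary

variable {N : ℕ} {L : ℝ}

/-- The phase `k·x = (2π/L) ∑ⱼ nⱼ xⱼ` (literally the crux's exponent). -/
def karg (L : ℝ) (n : Fin 3 → ℤ) (x : Space) : ℝ := 2 * Real.pi / L * ∑ j, (n j : ℝ) * x j

/-- `k·∇ᵢ g (X)` (directional derivative of `g` in particle `i` along `k`). -/
def kDeriv (L : ℝ) (n : Fin 3 → ℤ) (i : Fin N) (g : Config N → ℂ) (X : Config N) : ℂ :=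
  fderiv ℝ g X (Pi.single i (kvec L n))

/-- **The phased current–density integral** `W_θ(Φ) = ∑ᵢ ∫_{cell^N} cos(k·xᵢ + θ) · conj(Φ(X)) · (k·∇ᵢΦ)(X) dX`.
Only its IMAGINARY part is used: `Im W_θ(Φ) = ∑ᵢ∫cos(k·xᵢ+θ) Im(conj Φ k·∇ᵢΦ) = ∫ ∇f·j_Φ` (`f = sin(k·x+θ)`), the
longitudinal CURRENT quadrature, settled by the Ward chord (S1, proved). (Its real part is `|k|²/2 ×` the density wave
`D_{θ+π/2}` by parts — not needed.) -/
def phasedCurrent (θ : ℝ) (n : Fin 3 → ℤ) (Φ : PeriodicTrialState N L) : ℂ :=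
  ∑ i : Fin N, ∫ X in cellN N L,
    (Real.cos (karg L n (X i) + θ) : ℂ) * ((starRingEnd ℂ) (Φ.ψ X) * kDeriv L n i Φ.ψ X)

/-- **The phased density wave** `D_θ(Φ) = ∫_{cell^N} (∑ᵢ cos(k·xᵢ + θ)) |Φ(X)|² dX` — for `θ = 0` literally one half of
the source `∫(∑ᵢ 2cos(k·xᵢ))|Φ|²` of the route's crux `DensityResponse`; `D_{-π/2}` is the sine wave. -/
def densityWave (θ : ℝ) (n : Fin 3 → ℤ) (Φ : PeriodicTrialState N L) : ℝ :=
  ∫ X in cellN N L, (∑ i : Fin N, Real.cos (karg L n (X i) + θ)) * ‖Φ.ψ X‖ ^ 2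

/-- **The c-number condensate source** `X(Φ) = ⟨Φ, ∑ᵢ e^{ik·xᵢ} Pᵢ Φ⟩ = ⟨Φ, a_k†a_0 Φ⟩`
(`Pᵢ` = cell average in particle `i` = the crux's `P`, here `cellAvg` of Negative/ProductCalculus; for
Bose-symmetric `Φ` this is `(m+1) ∫ conj Φ · e^{ik·x₀} · P₀Φ`). -/
def condensateSource (n : Fin 3 → ℤ) (Φ : PeriodicTrialState N L) : ℂ :=
  ∑ i : Fin N, ∫ X in cellN N L,
    (starRingEnd ℂ) (Φ.ψ X) * Complex.exp (Complex.I * (karg L n (X i) : ℂ)) * cellAvg N L i Φ.ψ X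

/-- **The full `k`-current** `K(Φ) = ⟨Φ, ∑ᵢ (k·pᵢ) e^{ik·xᵢ} Φ⟩ = ½|k|²⟨ρ_k⟩_Φ + ½⟨{k·pᵢ, e^{ik·xᵢ}}⟩_Φ`, written
as `(|k|²/2)·(D₀ + i D_{-π/2}) + (Im W₀ + i Im W_{-π/2})`: one half `|k|² ×` the complex density wave
`∑ᵢ∫e^{ik·xᵢ}|Φ|² = D₀ + iD_{-π/2}` (`cos(· - π/2) = sin`) plus the longitudinal current
`J(Φ) = ∑ᵢ∫e^{ik·xᵢ} Im(conj Φ k·∇ᵢΦ)` (`p = -i∇`; `conj Φ·k·∇ᵢΦ = ½k·∇ᵢ|Φ|² + i Im(conj Φ k·∇ᵢΦ)` and one integration by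
parts of `e^{ik·xᵢ}·½k·∇ᵢ|Φ|²` on the torus identify this with the operator expectation). In modes:
`∑_p k·(p+k) ⟨a†_{p+k} a_p⟩` — NO `a_0†a_{-k}` leg, and the `p = 0` leg is `|k|² a_k†a_0`. -/
def kCurrent (n : Fin 3 → ℤ) (Φ : PeriodicTrialState N L) : ℂ :=
  ((ksq L n : ℂ) / 2) * ((densityWave 0 n Φ : ℂ) + Complex.I * (densityWave (-(Real.pi / 2)) n Φ : ℂ)) +
    (((phasedCurrent 0 n Φ).im : ℂ) + Complex.I * ((phasedCurrent (-(Real.pi / 2)) n Φ).im : ℂ))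

/-- **The backflow (no-condensate-leg longitudinal current)**
`R(Φ) = kCurrent(Φ) - |k|² X(Φ) = ∑ᵢ ⟨QᵢΦ, (k·pᵢ) e^{ik·xᵢ} QᵢΦ⟩ = ∑_{p ∉ {0,-k}} k·(p+k) ⟨a†_{p+k} a_p⟩_Φ`,
`Qᵢ = 1 - Pᵢ`: per particle `A = (k·p)∘e^{ik·x}` satisfies `P A = 0` on periodic `C¹` functions (the cell integral of an
`xᵢ`-derivative vanishes; `P` self-adjoint, `integral_conj_mul_cellAvg`) and `A P = |k|² e^{ik·x} P` (`PΦ` is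
`xᵢ`-independent), so `A = |k|² e^{ik·x}P + QAQ` in expectation. -/
def backflow (n : Fin 3 → ℤ) (Φ : PeriodicTrialState N L) : ℂ :=
  kCurrent n Φ - (ksq L n : ℂ) * condensateSource n Φ

end Vocabulary

/-! ### The statements: S1 (proved in the Ward-chord file), stubs S2–S4, and the intermediate `CNumberGD` -/

/-- **S1 — the Ward chord (f-sum rule in chord form; PROVED: `wardChord` in `…GaussianDominationCanWardChord.lean`, definition-free, and `wardChord_holds : WardChord` below).** For every pair potential `v`, every
`N`, `L`, every mode `n` and phase `θ`, every `s ≥ 0` and every periodic trial state `Φ`: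
`E₀^per(v,N,L) + s·|2 Im W_θ(Φ)| ≤ E_v(Φ) + s²·N|k|²`.
Proof plan: `f := sin(k·x + θ)` is `C¹` and `Lℤ³`-periodic with `∇f = k cos(k·x+θ)`; `Φ.phaseMul (t•f)` is a trial state,
so `E₀ ≤ E(e^{-it∑f(xⱼ)}Φ) = E(Φ) - GAIN(tf; Φ)` (`periodicForm_phaseMul`, `periodicEnergy_eq_periodicForm`), with
`GAIN(tf;Φ) = 2t∫∇f·j_Φ - t²∫|∇f|²n_Φ` (`phaseGain`), `∫∇f·j_Φ = ∑ᵢ∫cos(k·xᵢ+θ) Im(conj Φ k·∇ᵢΦ) = Im W_θ(Φ)`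
(`integral_sum_fderiv_mul_particleCurrent`, linearity of `fderiv` in the direction) and
`∫|∇f|²n_Φ = ∑ᵢ∫|k|²cos²(k·xᵢ+θ)|Φ|² ≤ N|k|²`; take `t = ±s`. Trivial when `E_v(Φ) = ⊤` (hard cores) and for `n = 0`
(`k = 0`, `W = 0`). No window, no density condition, no `IsRepulsiveFiniteRange`: an identity-level fact, now a
theorem (`wardChord`/`wardChord_holds`), reusable verbatim by `GDTransfer`/`FibreConductance` provers (KLS second variation `c_k`).
[Griffin1993 §6.1 (6.1)–(6.3); LSSY2005 §5.2 (5.19)–(5.23); Simon 1976 universal diamagnetism] -/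
def WardChord : Prop :=
  ∀ (v : ℝ → ℝ≥0∞) (N : ℕ) (L : ℝ) (n : Fin 3 → ℤ) (θ : ℝ) (s : ℝ), 0 ≤ s →
    ∀ Φ : PeriodicTrialState N L,
      periodicGroundStateEnergy v N L + ENNReal.ofReal (s * |2 * (phasedCurrent θ n Φ).im|) ≤
        periodicEnergy v Φ + ENNReal.ofReal (s ^ 2 * (N * ksq L n))

/-- **S2 — the weak density chord (≤ the route's rank-4 crux `DensityResponse`: theorem
`weakDensityChord_of_densityResponse` in `…WardSplitBridge.lean`; open on its own).** For every admissible `v` and window `M` there are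
`ρ₀, C, N₀` with: for `N ≥ N₀`, `L > 0`, `N ≤ ρ₀L³`, `n ≠ 0` in the window `2π‖n‖∞/L ≤ M√(N/L³)`, every phase `θ`, every
`s ≥ 0`, every `Φ`: `E₀^per + s·|D_θ(Φ)| ≤ E_v(Φ) + C s² N L²/‖n‖∞²` — the density-wave chord with the `ρa`-free budget
`N/k∞²` (`χ_ρρ(k) ≤ C'N/k²` uniformly down to `k = 2π/L`), i.e. `DensityResponse` with `ρa` dropped, a free phase `θ` and
the factor `2` moved into `s`. From `DensityResponse`: translate `Φ ↦ Φ(· - t𝟙)` with `t = (θ/|k|²)k`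
(`PeriodicTrialState.exists_translate`, `periodicEnergy_translate`, `setIntegral_cellN_comp_add_of_periodic`) — done in the bridge file.
Free gas: Mathieu, `C = O(1)`; Bogoliubov: `χ_ρρ/N = 2/(k² + 16πρa) ≤ 2/k²`. Why it might fail (as a standalone target): as
`DensityResponse` at `s → 0` — a true curvature bound; anomalously soft low-`k` density weight is excluded by no printed
method — but with the weaker budget `N/k²` in place of `N/(k²+ρa)`. -/
def WeakDensityChord : Prop :=
  ∀ v : ℝ → ℝ≥0∞, IsRepulsiveFiniteRange v → ∀ M : ℝ, 0 < M →
    ∃ ρ₀ C : ℝ, 0 < ρ₀ ∧ 0 < C ∧ ∃ N₀ : ℕ, ∀ N : ℕ, N₀ ≤ N → ∀ L : ℝ, 0 < L → (N : ℝ) ≤ ρ₀ * L ^ 3 →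
      ∀ n : Fin 3 → ℤ, n ≠ 0 → 2 * Real.pi * ‖(fun j => (n j : ℝ))‖ / L ≤ M * Real.sqrt (N / L ^ 3) →
      ∀ (θ : ℝ) (s : ℝ), 0 ≤ s → ∀ Φ : PeriodicTrialState N L,
        periodicGroundStateEnergy v N L + ENNReal.ofReal (s * |densityWave θ n Φ|) ≤
          periodicEnergy v Φ + ENNReal.ofReal (C * s ^ 2 * N * L ^ 2 / ‖(fun j => (n j : ℝ))‖ ^ 2)

/-- **S3 — the backflow chord (THE OPEN CORE; hardest stub).** For every admissible `v` and window `M` there are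
`ρ₀, C, N₀` with: in the crux's regime (`N ≥ N₀`, `N ≤ ρ₀L³`, `n ≠ 0`, `2π‖n‖∞/L ≤ M√ρ`), every `s ≥ 0`, every `Φ`:
`E₀^per + s·|R(Φ)| ≤ E_v(Φ) + C s² N|k|²` for the no-condensate-leg current `R = backflow`
(`= ∑_{p∉{0,-k}} k·(p+k)⟨a†_{p+k}a_p⟩`), i.e. `|⟨R⟩_Φ|² ≤ 4CN|k|²(E_v(Φ) - E₀)`.
Evidence: free gas `R Ψ₀ = 0`; Bogoliubov: one-phonon matrix element of `R` vanishes at quadratic order and is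
`(1-√x)²`-suppressed at cubic order (f-sum matching), two-phonon susceptibility
`≈ √(ρa³)(kξ)²(O(1) + c₀ log(1/kξ))·N|k|²`-sized against the budget `C N|k|²` (triage r1-1, r1-2; j010367).
HONEST STATUS (triage r1-3 §A; theorems `cnumberGD_of`, `backflowChord_of_cnumberGD` in the composition file): modulo S1 ∧ S2 this is
EQUIVALENT to `CNumberGD` — the phase-and-density Gaussian domination of the c-number source `a_k†a_0/√N` — by
`|k|²X = kCurrent - R` and the triangle inequality; the line's claim is structural (no condensate leg, explicit
infrared margin), not logical. Why it might fail: a world with `ρ_s → 0` at scale `L` (`T = 0` phase stiffness, the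
item's own why-might-fail) makes `κ(J^cond)` and `κ(R)` blow up together. Difficulty: open-problem. -/
def BackflowChord : Prop :=
  ∀ v : ℝ → ℝ≥0∞, IsRepulsiveFiniteRange v → ∀ M : ℝ, 0 < M →
    ∃ ρ₀ C : ℝ, 0 < ρ₀ ∧ 0 < C ∧ ∃ N₀ : ℕ, ∀ N : ℕ, N₀ ≤ N → ∀ L : ℝ, 0 < L → (N : ℝ) ≤ ρ₀ * L ^ 3 →
      ∀ n : Fin 3 → ℤ, n ≠ 0 → 2 * Real.pi * ‖(fun j => (n j : ℝ))‖ / L ≤ M * Real.sqrt (N / L ^ 3) →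
      ∀ s : ℝ, 0 ≤ s → ∀ Φ : PeriodicTrialState N L,
        periodicGroundStateEnergy v N L + ENNReal.ofReal (s * ‖backflow n Φ‖) ≤
          periodicEnergy v Φ + ENNReal.ofReal (C * s ^ 2 * (N * ksq L n))

/-- **c-number Gaussian domination** (the line's intermediate statement; NOT a stub — it is DERIVED from S1–S3 by
`cnumberGD_of`): the chord for the c-number condensate source `X(Φ) = ⟨Φ, ∑ᵢ e^{ik·xᵢ}PᵢΦ⟩ = ⟨a_k†a_0⟩_Φ` with the
crux's budget `×N`: `E₀^per + s|X(Φ)| ≤ E_v(Φ) + C s² N L²/‖n‖∞²` (i.e. `|⟨a_k†a_0⟩|² ≤ 4CN(L/‖n‖∞)²(E - E₀)`,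
Gaussian domination for `a_k†a_0/√N`, both quadratures). Bogoliubov: `x(u+v)²/e_k ≤ 1/k²` and `x k²/e_k² ≤ 1/k²`. -/
def CNumberGD : Prop :=
  ∀ v : ℝ → ℝ≥0∞, IsRepulsiveFiniteRange v → ∀ M : ℝ, 0 < M →
    ∃ ρ₀ C : ℝ, 0 < ρ₀ ∧ 0 < C ∧ ∃ N₀ : ℕ, ∀ N : ℕ, N₀ ≤ N → ∀ L : ℝ, 0 < L → (N : ℝ) ≤ ρ₀ * L ^ 3 →
      ∀ n : Fin 3 → ℤ, n ≠ 0 → 2 * Real.pi * ‖(fun j => (n j : ℝ))‖ / L ≤ M * Real.sqrt (N / L ^ 3) →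
      ∀ s : ℝ, 0 ≤ s → ∀ Φ : PeriodicTrialState N L,
        periodicGroundStateEnergy v N L + ENNReal.ofReal (s * ‖condensateSource n Φ‖) ≤
          periodicEnergy v Φ + ENNReal.ofReal (C * s ^ 2 * N * L ^ 2 / ‖(fun j => (n j : ℝ))‖ ^ 2)

/-- **S4 — the normalisation lift (transfer `CNumberGD → GaussianDominationCan`; size L–XL, BEC-strength).**
From the chord for the c-number-normalised source `∑ᵢ e^{ik·xᵢ}Pᵢ` (budget `C N L²/‖n‖²`) to the crux's chord for the
LNSS source `2(m+1)|∫ conj Φ · e^{ik·x₀} · Θ|`, `Θ = P₀ n̂₀^{-1/2}Φ = ∑_{S∋0}|S|^{-1/2}Q_SΦ` (budget `C L²/‖n‖²`), stated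
with the disprover's `GDCanWith` (the crux is `∀ v M ∃ ρ₀ C N₀, GDCanWith ρ₀ C N₀ v M` by `gaussianDominationCan_iff`,
`Iff.rfl`). Bose symmetry enters here (`∑ᵢ ↦ (m+1)×` particle `0`, `gaussianDominationCan_false_without_symm`), and so
does the Josephson factor: `Λ_k† = a_k†a_0 n̂₀^{-1/2}`, `χ̃(Λ) ≈ χ̃(X)/x` (`x = n₀/N`; ED j006865: ratio ∈ [0.87, 1.00]),
so the lift is BEC-STRENGTH on grossly uncondensed trial states: the crux demands `E(Φ) - E₀ ≳ k²n_k(Φ)/C` of them.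
Believed ingredients (card `gauge-split-backflow` NormalisationLift; triage r1-2 sharpen 2): `CNumberGD` for the
coupling path `t·v` + KLS mode counting (as in `GDTransfer`) ⇒ `𝔼[x̂(1-x̂)] ≤ ε` for near-minimisers; a
condensate-FLUCTUATION bound for near-minimisers (open; known in GP scaling only) to exclude the uncondensed branch;
continuity in `t` at fixed `(N,L)` (Perron–Frobenius); then division by `x ≥ 1 - ε'` and the trivial bound
`‖Λ‖ ≤ √(N+1)` on far states (`s ≥ 2k²√N/C`). Why it might fail: the fluctuation input is itself of condensation
type — this stub carries the condensate-fraction content of the crux in one named place. -/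
def NormalisationLift : Prop :=
  CNumberGD → ∀ v : ℝ → ℝ≥0∞, IsRepulsiveFiniteRange v → ∀ M : ℝ, 0 < M →
    ∃ ρ₀ C : ℝ, 0 < ρ₀ ∧ 0 < C ∧ ∃ N₀ : ℕ, GDCanWith ρ₀ C N₀ v M

/-! ### S1 holds (the line's lever is a theorem) -/

/-- **S1 holds**: the Ward chord `E₀^per + s|2 Im W_θ(Φ)| ≤ E_v(Φ) + s² N|k|²` for every `v, N, L, n, θ`, `s ≥ 0`, `Φ`
— the definition-free theorem `wardChord` (`BECThomsonPrincipleGaussianDominationCanWardChord.lean`) re-read in this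
vocabulary (`phasedCurrent`, `karg`, `kDeriv`, `kvec`, `ksq` unfold to its statement definitionally). [folklore] -/
theorem wardChord_holds : WardChord :=
  fun v N L n θ s hs Φ => wardChord v N L n θ s hs Φ

/-! ### Audit names of the stub statements

`Goal.stub_x` abbreviates the statement of the registered stub `stub_x`, so that the skeleton audit
(`#h21_check_skeleton`, by-name policy on hypothesis heads) reads the hypotheses of `GaussianDominationCan_of` as
exactly the three declared stubs (S1 is proved above: `wardChord_holds`). -/

namespace Goal

/-- Statement of stub S2 `stub_weakDensityChord`. -/
abbrev stub_weakDensityChord : Prop := WeakDensityChord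

/-- Statement of stub S3 `stub_backflowChord`. -/
abbrev stub_backflowChord : Prop := BackflowChord

/-- Statement of stub S4 `stub_normalisationLift`. -/
abbrev stub_normalisationLift : Prop := NormalisationLift

end Goal

/-! ### Elementary lemmas for the composition -/

section Lemmas

variable {N : ℕ} {L : ℝ}

/-- `|k|² ≥ 0`. [folklore] -/
theorem ksq_nonneg (L : ℝ) (n : Fin 3 → ℤ) : 0 ≤ ksq L n :=
  (sq_nonneg _).trans (ksupSq_le_ksq L n)

/-- `|k|² > 0` for `n ≠ 0`, `L ≠ 0`. [folklore] -/
theorem ksq_pos {L : ℝ} (hL : L ≠ 0) {n : Fin 3 → ℤ} (hn : n ≠ 0) : 0 < ksq L n := by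
  obtain ⟨j, hj⟩ := Function.ne_iff.mp hn
  have h1 : (1 : ℝ) ≤ (n j : ℝ) ^ 2 := by
    have h1' : (1 : ℤ) ≤ (n j) ^ 2 := by
      have := Int.one_le_abs hj
      nlinarith [sq_abs (n j), abs_nonneg (n j)]
    exact_mod_cast h1'
  have h2 : (n j : ℝ) ^ 2 ≤ ∑ i, (n i : ℝ) ^ 2 :=
    Finset.single_le_sum (f := fun i => (n i : ℝ) ^ 2) (fun i _ => sq_nonneg _) (Finset.mem_univ j)
  have h3 : 0 < (2 * Real.pi / L) ^ 2 := by
    have : 2 * Real.pi / L ≠ 0 := div_ne_zero (by positivity) hL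
    positivity
  unfold ksq
  exact mul_pos h3 (by linarith)

/-- `k∞² · L²/‖n‖∞² = 4π²`. [folklore] -/
theorem ksupSq_mul (hL : 0 < L) {n : Fin 3 → ℤ} (hn : n ≠ 0) :
    ksupSq L n * (L ^ 2 / ‖(fun j => (n j : ℝ))‖ ^ 2) = 4 * Real.pi ^ 2 := by
  unfold ksupSq
  have h1 : (0 : ℝ) < ‖(fun j => (n j : ℝ))‖ := lt_of_lt_of_le one_pos (one_le_norm_intVec hn)
  field_simp
  ring

/-- Square form of a chord family: `a + sF ≤ e + cs²` for all `s ≥ 0` (`c > 0`, `F ≥ 0`) gives `F² ≤ 4c(e - a)`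
(take `s = F/2c`). [folklore] -/
theorem sq_le_of_forall_chord {a e c F : ℝ} (hc : 0 < c) (hF : 0 ≤ F)
    (h : ∀ s : ℝ, 0 ≤ s → a + s * F ≤ e + c * s ^ 2) : F ^ 2 ≤ 4 * c * (e - a) := by
  have h1 := h (F / (2 * c)) (by positivity)
  have e1 : F / (2 * c) * F = 2 * (F ^ 2 / (4 * c)) := by field_simp; ring
  have e2 : c * (F / (2 * c)) ^ 2 = F ^ 2 / (4 * c) := by field_simp; ring
  rw [e1, e2] at h1
  have h2 : F ^ 2 / (4 * c) ≤ e - a := by linarith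
  have h3 := (div_le_iff₀ (by positivity : (0 : ℝ) < 4 * c)).mp h2
  linarith

/-- Chord family from the square form: `F² ≤ 4c(e - a)` (`c > 0`) gives `a + sF ≤ e + cs²` for all `s`
(`4csF ≤ F² + 4c²s²`). [folklore] -/
theorem forall_chord_of_sq_le {a e c F : ℝ} (hc : 0 < c) (h : F ^ 2 ≤ 4 * c * (e - a)) (s : ℝ) :
    a + s * F ≤ e + c * s ^ 2 := by
  have h1 : 0 ≤ (2 * c * s - F) ^ 2 := sq_nonneg _
  have h2 : 4 * c * (s * F) ≤ 4 * c * (c * s ^ 2 + (e - a)) := by nlinarith [h1, h]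
  have h3 : s * F ≤ c * s ^ 2 + (e - a) := le_of_mul_le_mul_left h2 (by positivity)
  linarith

/-- Reading an `ℝ≥0∞` chord at a finite-energy state as a real inequality. [folklore] -/
theorem ennreal_chord_iff {E₀ E : ℝ≥0∞} (hE : E ≠ ⊤) (hle : E₀ ≤ E) {x y : ℝ} (hx : 0 ≤ x) (hy : 0 ≤ y) :
    E₀ + ENNReal.ofReal x ≤ E + ENNReal.ofReal y ↔ E₀.toReal + x ≤ E.toReal + y := by
  have hE₀ : E₀ ≠ ⊤ := ne_top_of_le_ne_top hE hle
  set a := E₀.toReal with ha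
  set e := E.toReal with he
  rw [← ENNReal.ofReal_toReal hE₀, ← ENNReal.ofReal_toReal hE, ← ha, ← he,
    ← ENNReal.ofReal_add ENNReal.toReal_nonneg hx, ← ENNReal.ofReal_add ENNReal.toReal_nonneg hy,
    ENNReal.ofReal_le_ofReal_iff (by positivity)]

/-- The square form of an `ℝ≥0∞` chord family `E₀ + sF ≤ E + c s²` (all `s ≥ 0`) at a finite-energy state:
`F² ≤ 4c(E - E₀)`. [folklore] -/
theorem sq_le_of_ennreal_chords {E₀ E : ℝ≥0∞} (hE : E ≠ ⊤) (hle : E₀ ≤ E) {F c : ℝ} (hF : 0 ≤ F)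
    (hc : 0 < c)
    (h : ∀ s : ℝ, 0 ≤ s → E₀ + ENNReal.ofReal (s * F) ≤ E + ENNReal.ofReal (c * s ^ 2)) :
    F ^ 2 ≤ 4 * c * (E.toReal - E₀.toReal) :=
  sq_le_of_forall_chord hc hF fun s hs =>
    (ennreal_chord_iff hE hle (mul_nonneg hs hF) (by positivity)).mp (h s hs)

/-- `|2x|² ≤ 4bd` gives `|x|² ≤ bd`. [folklore] -/
theorem abs_sq_le_of_two_mul {x b d : ℝ} (h : |2 * x| ^ 2 ≤ 4 * b * d) : |x| ^ 2 ≤ b * d := by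
  rw [abs_mul, abs_two, mul_pow] at h
  linarith

end Lemmas

end Summit.AtomisticToContinuum.BoseEinsteinCondensation.Cruxes.GaussianDominationCan.WardChordSplitting

end
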